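import Summits.MatrixMultiplication.MatrixMultiplication.Cruxes.ThinPackings.Lines.cyclic_carry_charts
import Summits.MatrixMultiplication.MatrixMultiplication.Cruxes.ThinPackings.Lines.truncated_convolution_designs

/-!
# Sketch — crux-strategist gen 6 (planner-cstrat-stmt-MatrixMultiplication-10595-p6-0), crux `ThinBlockAlpha.ThinPackings`

First lemmas of the two crux ideas filed this seat (`cyclic-carry-charts`, `truncated-convolution-designs`), stated over
EXISTING declarations: the two strategist line modules (gen 1 / gen 2) are importable tree modules, so the signatures are
quoted by name and re-elaborated here (no new sorry: the `example`s below are definitional restatements of the lines'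
`Stmt.*` props, and the compositions to the crux are the lines' kernel-checked theorems).
-/

set_option linter.dupNamespace false

namespace Summit.MatrixMultiplication.MatrixMultiplication.Cruxes.ThinPackings.StrategistP6

open Literature.Computability.AlgebraicComplexity
open Summit.MatrixMultiplication.MatrixMultiplication.Theses.ThinBlockAlpha (ThinPackings)
open Summit.MatrixMultiplication.MatrixMultiplication.Cruxes.ThinPackings

/-- First lemma of idea `cyclic-carry-charts` (= line stub `stub_marginUSP`, M-sized, provable now): margin-digit USP cells
turn every CKSU local strong USP into a local CARRY-chart USP over the base interval `[0,q)`, `q ≥ 8`. -/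
example : CyclicCarryCharts.Stmt.stub_marginUSP =
    (∀ (q n L : ℕ), 8 ≤ q → ∀ (row : Fin L → Fin n → Fin 3), IsLocalStrongUSP row →
      CyclicCarryCharts.CellsBelow q (CyclicCarryCharts.uspCellA q) (CyclicCarryCharts.uspCellB q)
          (CyclicCarryCharts.uspCellC q) ∧
      (∀ x, CyclicCarryCharts.CarrySymbolTPP q (CyclicCarryCharts.uspCellA q) (CyclicCarryCharts.uspCellB q)
          (CyclicCarryCharts.uspCellC q) x) ∧
      CyclicCarryCharts.IsLocalCarryUSP q n (CyclicCarryCharts.uspCellA q) (CyclicCarryCharts.uspCellB q)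
          (CyclicCarryCharts.uspCellC q) row) := rfl

/-- The carry line concludes the crux by name (kernel-checked in the line module). -/
example : CyclicCarryCharts.Stmt.stub_carryCompiler → CyclicCarryCharts.Stmt.stub_carrySeeds → ThinPackings :=
  CyclicCarryCharts.ThinPackings_of

/-- First lemma of idea `truncated-convolution-designs` (= line stub `stub_slicedHosting`, L-sized, provable now; template
`AutomaticDesignBelowFourFifths.stub_digitwise` / `slicedSTPP_kernel`). -/
example : TruncatedConvolutionDesigns.Stmt.stub_slicedHosting → TruncatedConvolutionDesigns.Stmt.stub_windowDesigns →
    ThinPackings :=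
  TruncatedConvolutionDesigns.ThinPackings_of

/-- Typed by-product of this seat (gen 6, §T28 of the census): a monomial-degeneration FACE of the truncated convolution is cut
out by one additive equation, so (before taking powers) it is the restriction of the addition table of `ℤ × ℤ` to three lifted
digit sets — the design form of Alman–Vassilevska Williams' programme (arXiv:1712.07246 §1.3).  Stated for one coordinate; the
`N`-th power aggregates the potential coordinate (window `O(N)`), which is where the degeneration inequality `φ ≥ 0` is used. -/
theorem face_is_lifted_restriction (ℓ : ℕ) (φ₁ φ₂ φ₃ : ℕ → ℤ) (i j k : ℕ) :
    ((i : ℤ) + j + k = ℓ - 1 ∧ φ₁ i + φ₂ j + φ₃ k = 0) ↔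
      (((i : ℤ), φ₁ i) + ((j : ℤ), φ₂ j) + ((k : ℤ), φ₃ k) = ((ℓ : ℤ) - 1, 0)) := by
  constructor
  · rintro ⟨h1, h2⟩
    simp only [Prod.mk_add_mk, Prod.mk.injEq]
    exact ⟨h1, h2⟩
  · intro h
    simp only [Prod.mk_add_mk, Prod.mk.injEq] at h
    exact h

end Summit.MatrixMultiplication.MatrixMultiplication.Cruxes.ThinPackings.StrategistP6
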